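import Summits.RiemannHypothesis.RiemannHypothesis.Theorems.SemilocalDeletionToeplitzFloorUniform
import Summits.RiemannHypothesis.RiemannHypothesis.Theorems.SemilocalDeletionAllPowers
import Summits.RiemannHypothesis.RiemannHypothesis.Theorems.SemilocalDeletionCliffFalsifiers
import HarnessLib

/-!
# The ALL-WINDOW deletion floor `2·log p/(√p + 1)`: the RH-facing floor and the comb ceiling

`SemilocalDeletionToeplitzFloorUniform.lean` (p384390) proved that deleting a prime `p ∈ S` from the semi-local Weil form costs at most
`F_p·‖g‖₂²`, `F_p = 2·log p/(√p + 1)`, on EVERY window (`semilocalGroundEnergy_erase_ge_uniform`, set version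
`semilocalGroundEnergy_sdiff_ge_uniform`).  This file (cc-s2-1 gen14 desk, filed by gen18 with the set version taken from p384390) adds:

* §1 (RH-facing) `semilocalGroundEnergy_ge_neg_missing_floor_of_riemannHypothesis`: RH ⇒ for EVERY finite `S'`, every `c > 0` and every
  scaling-stable `P`, `λ_min(S'; c; P) ≥ −Σ_{p prime ≤ e^{2c}, p ∉ S'} 2·log p/(√p + 1)` — the UNIVERSAL RH FLOOR of
  `SemilocalDeletionCliffMulti` §4 with the sharp all-window constant (`2·log p/(√p + 1)` instead of `2·log p/(√p − 1)`);
  `not_riemannHypothesis_of_semilocalGroundEnergy_lt_neg_missing_floor` is the falsifier;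
* §2 `semilocalGroundEnergy_erase_add_mul_le_comb`: the `(n+1)`-block alternating comb of `SemilocalDeletionAllPowers` attains the floor up to
  `2F_p/(n+1)` plus the undeleted comb energy, and `comb_parity`: with an even block the comb has parity `(−1)^n` (the sector alternation
  «fast sector = parity of the number of visible powers» of the lineage-E data).

Constants `2·log p/(√p + 1)`: `0.574222` (p = 2), `0.804240` (3), `0.994687` (5), `1.067495` (7), `1.1513` (11) — against the
window-free MODULUS `2·log p/(√p − 1)` = `3.3468, 3.0015, 2.6041, 2.3648, 2.0702` and the single-atom cliff `log p/√p` =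
`0.4901, 0.6343, 0.7197, 0.7355, 0.7230`.  The finite-window sharpening `F̂_p(m) < F_p` is `SemilocalDeletionToeplitzBandEdge` (gen18).
Nothing here bears on RH; these are statements about truncated Weil forms (§1 is an «RH ⇒ …» necessary condition).
-/

set_option linter.dupNamespace false

noncomputable section

open Complex Filter Set MeasureTheory
open scoped Real Topology ComplexConjugate

namespace Summit.RiemannHypothesis.RiemannHypothesis.Theorems.SemilocalDeletionAllWindowFloor

open Literature.NumberTheory.LFunctions
open Summit.RiemannHypothesis.RiemannHypothesis.Theorems.SemilocalDeletionCliff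
open Summit.RiemannHypothesis.RiemannHypothesis.Theorems.SemilocalDeletionToeplitzFloorUniform
open Summit.RiemannHypothesis.RiemannHypothesis.Theorems.SemilocalDeletionAllPowers
open Summit.RiemannHypothesis.RiemannHypothesis.Theorems.HandoffSemilocalEnergy

variable {g : ℝ → ℂ}

variable {S : Finset ℕ} {p : ℕ}

variable {P : (ℝ → ℂ) → Prop}

/-! ## §1  RH-facing: the UNIVERSAL RH FLOOR with the sharp all-window constant -/

/-- **RH ⇒ every finite prime set sits above minus the all-window FLOOR masses of the missing visible primes.**
For any finite `S'`, any `c > 0` and any scaling-stable `P`: `λ_min(S'; c; P) ≥ −Σ_{p prime ≤ ⌊e^{2c}⌋, p ∉ S'} 2·log p/(√p + 1)`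
(sharpens `SemilocalDeletionCliffMulti` §4, whose constant is `2·log p/(√p − 1)`; e.g. the prime-free form: `λ_min(∅; c) ≥ −Σ_{p≤e^{2c}} 2 log p/(√p+1)`). -/
theorem semilocalGroundEnergy_ge_neg_missing_floor_of_riemannHypothesis (hRH : Summit.RiemannHypothesis) (S' : Finset ℕ)
    {c : ℝ} (hc : 0 < c) (hP : ∀ (a : ℝ) (g : ℝ → ℂ), 0 < a → P g → P fun t ↦ (a : ℂ) * g t) :
    -∑ p ∈ ((Finset.range (⌊Real.exp (2 * c)⌋₊ + 1)).filter Nat.Prime) \ S', 2 * Real.log p / (Real.sqrt p + 1) ≤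
      semilocalGroundEnergy S' P c := by
  classical
  set N : ℕ := ⌊Real.exp (2 * c)⌋₊ with hNdef
  set V : Finset ℕ := (Finset.range (N + 1)).filter Nat.Prime with hV
  have hcN : c ≤ Real.log ((N : ℝ) + 1) / 2 := by
    have : 2 * c < Real.log ((N : ℝ) + 1) := by
      rw [Real.lt_log_iff_exp_lt (by positivity)]; exact Nat.lt_floor_add_one _
    linarith
  -- `S := S' ∪ V` is visible-complete, `T := V \ S' ⊆ S` consists of primes, and `S \ T = S'`
  have hS : ∀ n ≤ N, IsPrimePow n → n.primeFactors ⊆ S' ∪ V := by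
    intro n hn _ q hq
    refine Finset.mem_union_right _ (Finset.mem_filter.2 ⟨Finset.mem_range.2 ?_, Nat.prime_of_mem_primeFactors hq⟩)
    have := Nat.le_of_mem_primeFactors hq
    omega
  have hT : ∀ q ∈ V \ S', q.Prime := fun q hq ↦ (Finset.mem_filter.1 (Finset.mem_sdiff.1 hq).1).2
  have hset : (S' ∪ V) \ (V \ S') = S' := by
    ext q
    simp only [Finset.mem_sdiff, Finset.mem_union]
    tauto
  have hpos : WeilSemilocalPositivityOn (S' ∪ V) c :=
    SemilocalDeletionCliffFalsifiers.weilSemilocalPositivityOn_of_riemannHypothesis hRH hS hc hcN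
  have h0 : 0 ≤ semilocalGroundEnergy (S' ∪ V) P c :=
    (semilocalGroundEnergy_nonneg_iff hP).2 fun g hg hs _ ↦ hpos g hg hs
  have h := semilocalGroundEnergy_sdiff_ge_uniform (S := S' ∪ V) (P := P) hT c
  rw [hset] at h
  linarith

/-- **Universal all-window FALSIFIER (floor constant).** A finite `S'`, a window `c > 0` and a scaling-stable `P` with
`λ_min(S'; c; P) < −Σ_{p prime ≤ ⌊e^{2c}⌋, p ∉ S'} 2·log p/(√p + 1)` refute RH. -/
theorem not_riemannHypothesis_of_semilocalGroundEnergy_lt_neg_missing_floor (S' : Finset ℕ) {c : ℝ} (hc : 0 < c)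
    (hP : ∀ (a : ℝ) (g : ℝ → ℂ), 0 < a → P g → P fun t ↦ (a : ℂ) * g t)
    (hlt : semilocalGroundEnergy S' P c <
      -∑ p ∈ ((Finset.range (⌊Real.exp (2 * c)⌋₊ + 1)).filter Nat.Prime) \ S', 2 * Real.log p / (Real.sqrt p + 1)) :
    ¬ Summit.RiemannHypothesis := fun hRH ↦ by
  have h := semilocalGroundEnergy_ge_neg_missing_floor_of_riemannHypothesis (P := P) hRH S' hc hP
  linarith


/-! ## §2  The floor is asymptotically ATTAINED: comb ceiling in energy language -/

/-- **Comb ceiling.** For `p ∈ S` prime, a block `h ∈ C(δ)` with `2δ < log p`, and the `(n+1)`-block alternating comb `G` of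
`SemilocalDeletionAllPowers` (window `n·log p/2 + δ`) whose positive multiples satisfy the constraint `P`:
`(λ_min(S∖p; n·log p/2 + δ; P) + (2·log p/(√p + 1))·(n−1)/(n+1))·‖G‖₂² ≤ Re Q_S(G)` — together with the all-window floor of
`SemilocalDeletionToeplitzFloorUniform` the deleted bottom sits in
`[λ_min(S) − F_p, −F_p·(n−1)/(n+1) + Re Q_S(G)/‖G‖₂²]`: the all-window floor is attained up to `2F_p/(n+1)` plus the UNDELETED comb energy. -/
theorem semilocalGroundEnergy_erase_add_mul_le_comb {h G : ℝ → ℂ} {δ : ℝ} {n : ℕ} (hh : IsWeilTest h)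
    (hsupp : tsupport h ⊆ Icc (-δ) δ) (hp : p.Prime) (hpS : p ∈ S) (hδ : 2 * δ < Real.log p)
    (hG : ∀ t : ℝ, G t = ∑ i ∈ Finset.range (n + 1), ((-1 : ℂ) ^ i) * h (t + n * Real.log p / 2 - i * Real.log p))
    (hP : ∀ a : ℝ, 0 < a → P fun t ↦ (a : ℂ) * G t) :
    (semilocalGroundEnergy (S.erase p) P (n * Real.log p / 2 + δ) + 2 * Real.log p / (Real.sqrt p + 1) * (((n : ℝ) - 1) / (n + 1))) *
        ∫ u : ℝ, ‖G u‖ ^ 2 ≤ (weilSemilocalQuadratic S G).re := by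
  have hL : 0 < Real.log p := Real.log_pos (by exact_mod_cast hp.one_lt)
  have hR := semilocalGroundEnergy_mul_le_re (S := S.erase p) (P := P) (isWeilTest_comb hG hh)
    (tsupport_comb_subset hG hsupp hL.le) hP
  have hC := re_weilSemilocalQuadratic_erase_comb_le hG hh hsupp hp hpS rfl hδ
  rw [add_mul]
  linarith

/-- **Sector of the comb.** If the block `h` is EVEN, the `(n+1)`-block alternating comb has parity `(−1)^n`: `G(−t) = (−1)^n·G(t)` —
even combs for even `n`, odd combs for odd `n` (the sector alternation «fast sector = parity of the number of visible powers» of the lineage-E data). -/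
theorem comb_parity {h G : ℝ → ℂ} {L : ℝ} {n : ℕ} (heven : ∀ t, h (-t) = h t)
    (hG : ∀ t : ℝ, G t = ∑ i ∈ Finset.range (n + 1), ((-1 : ℂ) ^ i) * h (t + n * L / 2 - i * L)) (t : ℝ) :
    G (-t) = (-1) ^ n * G t := by
  rw [hG, hG, Finset.mul_sum]
  -- reindex `i ↦ n − i`
  rw [← Finset.sum_range_reflect]
  refine Finset.sum_congr rfl fun i hi ↦ ?_
  have hi' : i ≤ n := Nat.lt_succ_iff.1 (Finset.mem_range.1 hi)
  have hcast : ((n - i : ℕ) : ℝ) = (n : ℝ) - i := by rw [Nat.cast_sub hi']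
  rw [show n + 1 - 1 - i = n - i from by omega, hcast]
  have harg : -t + n * L / 2 - ((n : ℝ) - i) * L = -(t + n * L / 2 - i * L) := by ring
  rw [harg, heven, ← mul_assoc, ← pow_add]
  congr 1
  -- `(-1)^(n-i) = (-1)^(n+i)` since the exponents differ by `2i`
  rw [show n + i = (n - i) + 2 * i by omega, pow_add, pow_mul]
  norm_num

end Summit.RiemannHypothesis.RiemannHypothesis.Theorems.SemilocalDeletionAllWindowFloor

end
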